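import Literature.AlgebraicGeometry.ProjectiveGeometry.AmpleLocusOpen
import Literature.AlgebraicGeometry.AbelianVarieties.LefschetzThreeThetaVeryAmple
import Literature.AlgebraicGeometry.AbelianVarieties.SymmetricAmpleExtOneVanishing
import Literature.AlgebraicGeometry.AbelianVarieties.SymmetricDivisorClassPullback
import Literature.AlgebraicGeometry.AbelianVarieties.LineBundleTensorPower
import Literature.AlgebraicGeometry.AbelianVarieties.HomogeneousLineBundleDivisor
import Literature.AlgebraicGeometry.AbelianSchemes.AbelianSchemePolarization
import Literature.AlgebraicGeometry.AbelianSchemes.IsLambdaOfAtBezout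
import Literature.AlgebraicGeometry.Modules.SerreTwistOneAmplePullback
import Literature.AlgebraicGeometry.Motives.GeneratingSectionsSerreTwistClass
import Literature.AlgebraicGeometry.Morphisms.SectionsProjectiveOfFibreVanishing
import HarnessLib

/-!
# The ample locus of a line bundle on an abelian scheme is open ([GortzWedhorn2023] Thm. 24.46 ∕ Cor. 27.285 shape):
# ample (symmetric, char-0 witness) on ONE geometric fibre ⇒ ample on EVERY fibre over an open neighbourhood

Layer `Literature/AlgebraicGeometry/AbelianSchemes`, namespace `Literature.AlgebraicGeometry.AbelianSchemes.AbelianSchemeOver`.  THEOREMS ONLY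
(no definition, no named fact, no instance, no notation, no `sorry`); universe `Scheme.{0}`.  Cell `hodgecm-mathlib` (D-0151), P6 «MOD
programme», organ «AmpleLocusOpen» FILE 3∕3 (LEAD F0P6-plan (g2) RULING 2026-09-01 22:26:05Z; B-p10 (g29)): the abelian-scheme dictionary
over ★ `ProjectiveGeometry/AmpleLocusOpen` (the very-ample locus is open).  Consumer: ★ `PolarizationSpreadStage` §3
(`exists_stage_polarization_of_isOpen_locus`, hypothesis `hopen` = [GortzWedhorn2023] Cor. 27.285 shape) at `L := L^Δ(λ)`, and E6-Π.
Count-neutral: HC_CM is proved only modulo the printed citations until rung 0 closes — nothing here bears on a summit.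

* §1 **`exists_isAmple_iso_lineBundleOfDivisor_of_toProj_tensorPow`** — at ANY field-valued point `y`: if the fibre `A_y` is embedded into
  `ℙ^m` by finitely many of its own sections of `L^{⊗q}|_{A_y}` (`q ≥ 1`), then `L|_{A_y} ≅ 𝒪(Θ₀)` with `Θ₀` AMPLE (`φ^*𝒪(1) ≅ L^{⊗q}|`,
  Hartshorne II Thm. 7.1 ★ `nonempty_twistMod_toProj_iso`; `𝒪_{A_y}(1) ≅ 𝒪(Θ″)` ample ★ `SerreTwist.exists_isAmple_nonempty_twistMod_one_iso_lineBundle`;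
  `L| ≅ 𝒪(Θ₀)` ★ `exists_iso_lineBundle_toUnitCocycle`; `[q • Θ₀] = [Θ″]`, so `q • Θ₀` and `Θ₀` are ample ★ `IsAmple.of_smul`).
* §2 **`exists_opens_forall_isAmple_iso_lineBundleOfDivisor`** — THE HEAD: `T` locally Noetherian, `𝒜` an abelian scheme over `T`, `L` of
  rank one on `A`, `x ∈ T`; if at ONE field-valued point `x̄ : Spec Ω → T` centred at `x` with `Ω` of CHARACTERISTIC `0` one has
  `L|_{A_x̄} ≅ 𝒪(Θ)` with `Θ` ample and SYMMETRIC, then over an OPEN `U ∋ x`, at EVERY field-valued `ȳ` landing in `U` (any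
  characteristic), `L|_{A_ȳ} ≅ 𝒪(Θ′)` with `Θ′` ample.  Proof: `E := L^{⊗3}` restricts on `A_x̄` to `𝒪(3Θ)`, which has `H¹ = 0`
  ([MumfordAV1970] §16, ★ `subsingleton_ext_one_lineBundle_of_symmetric_isAmple`) and embeds `A_x̄` by any spanning family of sections
  ([MumfordAV1970] §17 Lefschetz, ★ `isClosedImmersion_toProj_of_iso_lineBundle_three_nsmul` — `CharZero` in the tree; finite spanning family
  by §5 Cor. 2, ★ `finite_and_projective_secMod_top_of_forall_fiber`); ★ `exists_opens_forall_fibre_isClosedImmersion_toProj` gives `U`; §1.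
  WHY the two binders: Lefschetz is `CharZero` and the `H¹`-vanishing is symmetric-only IN THE TREE; both hold at the consumer's witness points
  (generic base over `ℚ`, `L^Δ(λ)` of class `[Θ₁ + (−1)^*Θ₁]` by ★ `detClass_restrict_LDelta_eq_cechClass_add_pullback_neg`); the conclusion
  is characteristic-free on `U`.

## References
* [GortzWedhorn2023] U. Görtz, T. Wedhorn, *Algebraic Geometry II* (2023), Thm. 24.46 (p. 397), Cor. 27.285 (p. 723), Rem. 27.185.
* [EGAIII1] A. Grothendieck, J. Dieudonné, *EGA III₁* (1961), Thm. (4.7.1) (p. 145).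
* [MumfordAV1970] D. Mumford, *Abelian Varieties* (1970), §5 Cor. 2–3 (pp. 50–53), §16 (the vanishing theorem), §17 (Lefschetz).
* [GortzWedhorn2020] U. Görtz, T. Wedhorn, *Algebraic Geometry I*, 2nd ed. (2020), Prop. 13.50 (1) (p. 394), Prop. 13.66 (2) (p. 402).
* [Hartshorne1977] R. Hartshorne, *Algebraic Geometry* (1977), II Thm. 7.1 (p. 150), II Prop. 6.15, III Ex. 4.5.
-/

noncomputable section

-- `TopCat.Presheaf`/`Scheme.Modules` and pull-back bookkeeping (as in ★ `AbelianSchemes/AbelianSchemeLDeltaFibreH1Vanishing`).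
set_option backward.isDefEq.respectTransparency false

open CategoryTheory CategoryTheory.Limits CategoryTheory.Abelian AlgebraicGeometry TopologicalSpace Opposite

namespace Literature.AlgebraicGeometry.AbelianSchemes

namespace AbelianSchemeOver

open Literature.AlgebraicGeometry.Morphisms Literature.AlgebraicGeometry.Modules Literature.AlgebraicGeometry.Motives
open Literature.AlgebraicGeometry.Motives.GeneratingSections Literature.AlgebraicGeometry.Modules.SerreTwist
open Literature.AlgebraicGeometry.Morphisms.ProjCech

/-- `Ext`-vanishing transports along an isomorphism of the second argument. [folklore] -/
private theorem subsingleton_ext_of_iso'' {C : Type*} [Category C] [Abelian C] [HasExt.{1} C] (P : C) {Y Y' : C}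
    (e : Y ≅ Y') (i : ℕ) (h : Subsingleton (Ext.{1} P Y' i)) : Subsingleton (Ext.{1} P Y i) := by
  refine subsingleton_of_forall_eq 0 fun x => ?_
  have hx : x = (x.comp (Ext.mk₀ e.hom) (add_zero i)).comp (Ext.mk₀ e.inv) (add_zero i) := by
    rw [Ext.comp_assoc_of_second_deg_zero, Ext.mk₀_comp_mk₀, e.hom_inv_id, Ext.comp_mk₀_id]
  rw [hx, Subsingleton.elim (x.comp (Ext.mk₀ e.hom) (add_zero i)) 0, Ext.zero_comp]

/-! ### §1 A fibre embedded by its own sections of `L^{⊗q}|` carries an ample `Θ₀` with `L| ≅ 𝒪(Θ₀)` -/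

section Fibre

variable {T : Scheme.{0}} (𝒜 : AbelianSchemeOver T) (L : 𝒜.X.left.Modules) (hL : HasRank L 1)

include hL in
/-- **A fibre embedded by sections of `L^{⊗q}|_{A_y}` has `L|_{A_y} ≅ 𝒪(Θ₀)` with `Θ₀` AMPLE** (`q ≥ 1`, `y` any field-valued point):
`φ^*𝒪(1) ≅ L^{⊗q}|` for the closed immersion `φ : A_y ↪ ℙ^m` the sections define (★ `nonempty_twistMod_toProj_iso`, Hartshorne II
Thm. 7.1), `𝒪_{A_y}(1) ≅ 𝒪(Θ″)` with `Θ″` ample (★ `SerreTwist.exists_isAmple_nonempty_twistMod_one_iso_lineBundle`, [GortzWedhorn2020]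
Prop. 13.66 (2)), `L|_{A_y} ≅ 𝒪(Θ₀)` for some `Θ₀` (★ `exists_iso_lineBundle_toUnitCocycle`, Hartshorne II Prop. 6.15), and
`[q • Θ₀] = [Θ″]` in `Ȟ¹(A_y, 𝒪^×)` (★ `detClass_tensorPow`, ★ `detClass_pullback`), so `q • Θ₀ ∼ Θ″` is ample and so is `Θ₀`
(★ `IsAmple.of_smul`, [GortzWedhorn2020] Prop. 13.50 (1)). [cite: Hartshorne1977, II Thm. 7.1 (p. 150) and II Prop. 6.15]
[cite: GortzWedhorn2020, Prop. 13.66 (2) (p. 402) and Prop. 13.50 (1) (p. 394)] -/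
theorem exists_isAmple_iso_lineBundleOfDivisor_of_toProj_tensorPow {q : ℕ} (hq : 0 < q) {K : Type} [Field K]
    (y : Spec (.of K) ⟶ T) (G : FrameSystem ((Scheme.Modules.pullback (pullback.fst 𝒜.X.hom y)).obj (tensorPow L q)))
    (hG : ∀ z, G.rank z = 1) {m : ℕ} (t : Fin (m + 1) → Γ((Scheme.Modules.pullback (pullback.fst 𝒜.X.hom y)).obj (tensorPow L q), ⊤))
    (hcov : ⨆ i, ⨆ z, (pullback 𝒜.X.hom y).basicOpen ((CocycleSections.ofFrameSystem G hG t).coeff i z) = ⊤)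
    (H : IsClosedImmersion ((ofCocycleSections G.U (CocycleSections.ofFrameSystem G hG t) hcov).toProj (pullback.snd 𝒜.X.hom y))) :
    ∃ Θ₀ : CartierDivisor (𝒜.fibre y).toAbelianVariety.X.left, Θ₀.IsAmple ∧
      Nonempty ((Scheme.Modules.pullback (pullback.fst 𝒜.X.hom y)).obj L ≅ 𝒜.lineBundleOfDivisor y Θ₀) := by
  let B : AbelianVariety K := (𝒜.fibre y).toAbelianVariety
  haveI : IsIntegral B.X.left :=
    haveI := B.geometricallyIntegral
    GeometricallyIntegral.isIntegral_of_subsingleton B.X.hom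
  haveI : IsIntegral (pullback 𝒜.X.hom y) := ‹IsIntegral B.X.left›
  let pr : B.X.left ⟶ 𝒜.X.left := pullback.fst 𝒜.X.hom y
  let Eq : B.X.left.Modules := (Scheme.Modules.pullback pr).obj (tensorPow L q)
  let φ : B.X.left ⟶ PP K m := (ofCocycleSections G.U (CocycleSections.ofFrameSystem G hG t) hcov).toProj (pullback.snd 𝒜.X.hom y)
  haveI : IsClosedImmersion φ := H
  -- `φ^*𝒪(1) ≅ L^{⊗q}|` and `𝒪(1) ≅ 𝒪(Θ″)`, `Θ″` ample
  obtain ⟨e1⟩ := nonempty_twistMod_toProj_iso (pullback.snd 𝒜.X.hom y) G hG t hcov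
  obtain ⟨Θ'', hΘ'', ⟨e2⟩⟩ := SerreTwist.exists_isAmple_nonempty_twistMod_one_iso_lineBundle φ
  -- `L| ≅ 𝒪(Θ₀)`
  have hLq : HasRank ((Scheme.Modules.pullback pr).obj L) 1 := hasRank_pullback pr hL
  obtain ⟨Θ₀, ⟨e0⟩⟩ := exists_iso_lineBundle_toUnitCocycle hLq
  refine ⟨Θ₀, ?_, ⟨e0⟩⟩
  -- classes: `[q • Θ₀] = [L|]^q = [L^{⊗q}|] = [Θ″]`
  have hL₁ : IsFiniteLocallyFree L := HasRank.isFiniteLocallyFree' hL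
  have hEq : IsFiniteLocallyFree Eq := (isFiniteLocallyFree_tensorPow hL₁ q).pullback pr
  have hcl : (q • Θ₀).cechClass = Θ''.cechClass := by
    rw [← detClass_eq_cechClass_of_iso (e1.symm ≪≫ e2) hEq, cechClass_smul',
      ← detClass_eq_cechClass_of_iso e0 (hL₁.pullback pr), detClass_pullback (hE := hL₁),
      detClass_pullback (hE := isFiniteLocallyFree_tensorPow hL₁ q), detClass_tensorPow hL hL₁ q, map_pow]
    rfl
  exact CartierDivisor.IsAmple.of_smul hq ((CartierDivisor.linEquiv_of_cechClass_eq hcl).symm.isAmple hΘ'')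

end Fibre

/-! ### §2 The ample locus of a rank-one `L` on an abelian scheme is open (geometric-point ∕ Cor. 27.285 shape) -/

section Locus

variable {T : Scheme.{0}} [IsLocallyNoetherian T] (𝒜 : AbelianSchemeOver T) (L : 𝒜.X.left.Modules) (hL : HasRank L 1)
  (x : T) {Ω : Type} [Field Ω] [CharZero Ω] (xb : Spec (.of Ω) ⟶ T) (hx : x ∈ Set.range xb)
  {Θ : CartierDivisor (𝒜.fibre xb).toAbelianVariety.X.left} (hΘ : Θ.IsAmple)
  (hsym : (Θ.pullback (AbelianVariety.Hom.toSchemeHom (-𝟙 (𝒜.fibre xb).toAbelianVariety))).LinEquiv Θ)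
  (e : Nonempty ((Scheme.Modules.pullback (pullback.fst 𝒜.X.hom xb)).obj L ≅ 𝒜.lineBundleOfDivisor xb Θ))

include hL hx hΘ hsym e in
/-- **THE AMPLE LOCUS IS OPEN for a rank-one `L` on an abelian scheme** ([GortzWedhorn2023] Thm. 24.46 ∕ [EGAIII1] Thm. 4.7.1 for
`A → T`, in the geometric-point letter of [GortzWedhorn2023] Cor. 27.285 = ★ `PolarizationSpreadStage` §3 `hopen` minus `IsLambdaOfAt`).
`T` locally Noetherian, `𝒜` an abelian scheme over `T`, `L` of rank one on `A`, `x ∈ T`; IF at ONE field-valued point `x̄ : Spec Ω → T`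
centred at `x`, `Ω` of CHARACTERISTIC `0` (Lefschetz §17 is `CharZero` in the tree), `L|_{A_x̄} ≅ 𝒪(Θ)` with `Θ` AMPLE and SYMMETRIC
(`(−1)^*Θ ∼ Θ`; e.g. `L = L^Δ(λ)`, class `[Θ₁ + (−1)^*Θ₁]`, ★ `detClass_restrict_LDelta_eq_cechClass_add_pullback_neg`), THEN there is an
OPEN `U ∋ x` such that at EVERY field-valued point `ȳ : Spec Ω′ → T` landing in `U` (any characteristic), `L|_{A_ȳ} ≅ 𝒪(Θ′)` with
`Θ′` AMPLE.  Proof: `E := L^{⊗3}` restricts on `A_x̄` to `𝒪(3Θ)` (classes), which has `H¹ = 0` ([MumfordAV1970] §16, ★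
`subsingleton_ext_one_lineBundle_of_symmetric_isAmple`) and embeds `A_x̄` by any spanning family of its sections ([MumfordAV1970] §17,
★ `isClosedImmersion_toProj_of_iso_lineBundle_three_nsmul`; a finite spanning family by [MumfordAV1970] §5 Cor. 2, ★
`finite_and_projective_secMod_top_of_forall_fiber`); ★ `exists_opens_forall_fibre_isClosedImmersion_toProj` gives the open `U` over which
every fibre is embedded by its own sections of `E|`, and §1 reads off the ample `Θ′`.
[cite: GortzWedhorn2023, Thm. 24.46 (p. 397) and Cor. 27.285 (p. 723)] [cite: EGAIII1, Thm. (4.7.1) p. 145]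
[cite: MumfordAV1970, §16 (the vanishing theorem), §17 (Lefschetz) and §5 Cor. 2–3 (pp. 50–53)] -/
theorem exists_opens_forall_isAmple_iso_lineBundleOfDivisor :
    ∃ U : T.Opens, x ∈ U ∧ ∀ (Ω' : Type) [Field Ω'] (yb : Spec (.of Ω') ⟶ T), Set.range yb ⊆ (U : Set _) →
      ∃ Θ' : CartierDivisor (𝒜.fibre yb).toAbelianVariety.X.left, Θ'.IsAmple ∧
        Nonempty ((Scheme.Modules.pullback (pullback.fst 𝒜.X.hom yb)).obj L ≅ 𝒜.lineBundleOfDivisor yb Θ') := by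
  classical
  haveI : IsProper 𝒜.X.hom := 𝒜.isProper
  haveI : Smooth 𝒜.X.hom := 𝒜.isSmooth
  -- `E := L^{⊗3}` with a rank-one frame system
  let E : 𝒜.X.left.Modules := tensorPow L 3
  have hL₁ : IsFiniteLocallyFree L := HasRank.isFiniteLocallyFree' hL
  have hE : HasRank E 1 := hasRank_tensorPow_one hL 3
  obtain ⟨F, h1⟩ := exists_frameSystem_of_hasRank hE
  -- the fibre `B = A_x̄` and `E|_B ≅ 𝒪(3Θ)`
  let B : AbelianVariety Ω := (𝒜.fibre xb).toAbelianVariety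
  haveI : IsIntegral B.X.left :=
    haveI := B.geometricallyIntegral
    GeometricallyIntegral.isIntegral_of_subsingleton B.X.hom
  haveI : IsIntegral (pullback 𝒜.X.hom xb) := ‹IsIntegral B.X.left›
  let pr : B.X.left ⟶ 𝒜.X.left := pullback.fst 𝒜.X.hom xb
  let f₁ : B.X.left ⟶ Spec (.of Ω) := pullback.snd 𝒜.X.hom xb
  have H₁ : IsPullback pr f₁ 𝒜.X.hom xb := IsPullback.of_hasPullback _ _
  haveI : IsProper f₁ := MorphismProperty.pullback_snd (P := @IsProper) _ _ inferInstance
  haveI : Flat f₁ := MorphismProperty.pullback_snd (P := @Flat) _ _ inferInstance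
  obtain ⟨e⟩ := e
  let EB : B.X.left.Modules := (Scheme.Modules.pullback pr).obj E
  have hEB : IsFiniteLocallyFree EB := (isFiniteLocallyFree_tensorPow hL₁ 3).pullback pr
  obtain ⟨e3⟩ : Nonempty (EB ≅ lineBundle (3 • Θ).toUnitCocycle) := by
    refine (nonempty_iso_iff_detClass_eq (hasRank_pullback pr hE) (3 • Θ).toUnitCocycle.hasRank_lineBundle hEB
      (3 • Θ).toUnitCocycle.isFiniteLocallyFree_lineBundle).2 ?_
    rw [detClass_lineBundle_toUnitCocycle, cechClass_smul', ← detClass_eq_cechClass_of_iso e (hL₁.pullback pr),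
      detClass_pullback (hE := hL₁), detClass_pullback (hE := isFiniteLocallyFree_tensorPow hL₁ 3), detClass_tensorPow hL hL₁ 3, map_pow]
    rfl
  -- `H¹(B, E|_B) = 0` (Mumford §16 for the symmetric ample `3Θ`)
  have hsym3 : ((3 • Θ).pullback (AbelianVariety.Hom.toSchemeHom (-𝟙 B))).LinEquiv (3 • Θ) := by
    rw [← AbelianVarieties.symmetric_iff_pullback_neg_id_linEquiv (X := B) _] at hsym ⊢
    exact AbelianVarieties.symmetric_nsmul hsym 3
  have hvan : Subsingleton (Ext.{1} (unitModule B.X.left) EB 1) := by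
    haveI := B.subsingleton_ext_one_lineBundle_of_symmetric_isAmple (3 • Θ) (hΘ.smul (by norm_num)) hsym3
    exact subsingleton_ext_of_iso'' (unitModule B.X.left) e3 1 inferInstance
  -- a finite spanning family of `Γ(B, E|_B)` (Mumford §5 Cor. 2 on `B → Spec Ω`)
  have hvan₀ : ∀ y : Spec (.of Ω), Subsingleton (Ext.{1} (unitModule (f₁.fiber y))
      ((Scheme.Modules.pullback (f₁.fiberι y)).obj EB) 1) := by
    intro y
    obtain ⟨ψ, hψ⟩ := Spec.map_surjective ((Spec (.of Ω)).fromSpecResidueField y)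
    have Hy : IsPullback (f₁.fiberι y) (f₁.fiberToSpecResidueField y) f₁ (Spec.map (CommRingCat.ofHom ψ.hom)) := by
      change IsPullback _ _ _ (Spec.map ψ)
      rw [hψ]
      exact IsPullback.of_hasPullback _ _
    haveI := hEB.isVectorBundle.1
    exact (subsingleton_ext_unit_succ_iff_of_isPullback_specMap ψ.hom Hy EB (IsAffineLocalizing.of_isQuasicoherent EB) 0).mpr hvan
  obtain ⟨hfin, -⟩ := finite_and_projective_secMod_top_of_forall_fiber f₁ EB hEB hvan₀
  haveI := hfin
  obtain ⟨n, σ, hσ⟩ := Module.Finite.exists_fin (R := Γ(Spec (.of Ω), ⊤)) (M := SecMod EB f₁.appTop.hom ⊤)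
  let s : Fin (n + 1) → Γ(EB, ⊤) := Fin.cons 0 fun l ↦ SecMod.val (ρ := f₁.appTop.hom) (σ l)
  have hs : ∀ τ : Γ(EB, ⊤), SecMod.mk (L := EB) (ρ := f₁.appTop.hom) (U := ⊤) τ ∈
      Submodule.span Γ(Spec (.of Ω), ⊤) (Set.range fun l ↦ SecMod.mk (L := EB) (ρ := f₁.appTop.hom) (U := ⊤) (s l)) := by
    intro τ
    refine Submodule.span_mono ?_ (hσ.symm ▸ Submodule.mem_top)
    rintro _ ⟨l, rfl⟩
    exact ⟨l.succ, by simp only [s, Fin.cons_succ, SecMod.mk_val]⟩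
  -- Lefschetz: the spanning family embeds `B`
  have h1₁ : ∀ z, (F.pullback pr).rank z = 1 := fun z ↦ h1 (pr.base z)
  obtain ⟨hcov, Hemb⟩ := B.isClosedImmersion_toProj_of_iso_lineBundle_three_nsmul hΘ EB e3 (F.pullback pr) h1₁ s hs
  -- the very-ample locus is open
  obtain ⟨U, hxU, hU⟩ := exists_opens_forall_fibre_isClosedImmersion_toProj 𝒜.X.hom F h1 x xb hx H₁ hvan h1₁ s hcov Hemb
  refine ⟨U, hxU, fun Ω' _ yb hyb ↦ ?_⟩
  obtain ⟨m, s', hcov', H'⟩ := hU Ω' yb hyb (pullback.fst 𝒜.X.hom yb) (pullback.snd 𝒜.X.hom yb) (IsPullback.of_hasPullback _ _)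
  exact 𝒜.exists_isAmple_iso_lineBundleOfDivisor_of_toProj_tensorPow L hL (by norm_num : 0 < 3) yb (F.pullback _) _ s' hcov' H'

end Locus

end AbelianSchemeOver

end Literature.AlgebraicGeometry.AbelianSchemes

end
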